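import Summits.QuantumFields.BalabanUV.T4Continuum.Support.ShellMeasureRootCompositionFibre
import Literature.MathematicalPhysics.QuantumFieldTheory.Balaban1983to89.B12Lineariz267

/-!
# `T4Continuum.ShellMeasureLinearizedConstraint` — (LR)_j, CONSTRAINED READING: the slot law ON THE FIBRE of a
# linearizable average is the image of «Lebesgue on the linear fibre `Kf` × exterior law, with density» under the
# curved fibre chart; END-II (fibre form) transports along it; and PRINT'S SUBSTITUTION `B ↦ B − hD̃(B)`
# ([Balaban1987RG1] p. 267) supplies the chart's structural hypotheses BY NAME from the tree leaf `B12Lineariz267`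
# (cell `pub-balaban`, sub-cell `t4`, spine estimate NE7c (node U5b); NE7c ROUND-2 crew `t4-ne7c-formalise-*`, seat
# `b2b-balaban-t4-ne7c-formalise-leaf-09` (gen 7); file 2 of the OFFER «the curved fibre chart for a linearizable
# average» (journal `CLAIMS.log` l.11567; file 1 = `ShellMeasureLinearizedChart`, the MARGINAL reading, not imported);
# ADDITIVE — imports FC f3 `ShellMeasureRootCompositionFibre` (p211549) and the Literature leaf `B12Lineariz267` (§1,
# the ring-level algebra of the substitution) only, modifies nothing; 0 `def`, 0 sorry, 0 cite)

HONEST FRAMING.  Finite four-torus programme, rung (B)+1 only — NOT infinite volume, NOT a mass gap, NOT the Clay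
problem, NOT summit progress; (B), `BetaPertHyp`, (B^μ) are not consumed.  (M1) for Bałaban's inductively defined
effective measures is NOT PRINTED (GAPS G-ne7cp1-1), asserted by nobody, NOT moved here.  NE7c ⇐ the named binders
(trigger c3); NE7c NOT PRINTED, NOT proved; spine PROVED 0/9 before and after.  STRUCTURAL BOOKKEEPING — [folklore]
measure theory and linear algebra; the one printed device used (the substitution of [Balaban1987RG1] p. 267) enters
ONLY through the tree leaf `B12Lineariz267` §1 BY NAME (its ring-level identities `linearizes`, `injOn_phi`), nothing
of it is re-quoted or re-derived; no estimate, no `def` (c2), no citation of our own.  HONEST DEPENDENCY (cell,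
verbatim): continuum YM on T⁴ ⇐ BetaPertH ∧ nine spine estimates (0/9 proved); BetaPertH ⇐ (D1) ∧ (D4) ∧ CAP+tail;
G-an2-4 gates asym, D1 and NE2/3/4.

THE POINT.  Print's fluctuation integral carries the AVERAGING CONSTRAINT as a δ-function of a NONLINEAR average,
«δ(Q̃(B′))» ([Balaban1987RG1] (2.10) p. 267; [Balaban1989LargeFieldI] (1.25)), and removes the nonlinearity by the
substitution «B′ = B − hD̃(B) linearizes the function Q̃(B′) … The above change of variables yields the integral with
the δ-function δ(Q̃B)» (p. 267), `LQ̃` linear with the right inverse `h` («LQ̃h = I»).  After it the constraint is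
LINEAR, the fibre is (a window in) `ker LQ̃`, and the fibre law is Lebesgue measure on `ker LQ̃` with the pulled-back
density (Jacobian «Tr log(I − h(δ/δB)D̃)» of (2.12) included), pushed forward by the curved chart
`x ↦ x − hD̃(x)`.  So in the CONSTRAINED reading of (LR)_j (typer T-NE7c-8; FC f3's fibre END) the realized slot law
of a live slot HAS the shape «image of `(μK ⊗ ζ).withDensity Ft` under `(x, z) ↦ (chart_z x, z)`», and (M1)
transports along images (`T4ShellMeasureDet.slotAntiConcentration_map`):
* §1 `slotAC_constrainedFibre_of_levelData` — THE END, CONSTRAINED READING: for fibre charts `x ↦ Φ z (Ψ z (x, 0))`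
  (a linear splitting `Ψ z : Kf × F ≃ E` of the linearized average and a curved chart `Φ z`, per exterior point `z`,
  jointly measurable), a measurable fibre density `Ft` on `Kf × Z` with finite slices and a measurable tested variable
  `u` on `E × Z`: E2′'s level data + dictionary IN THE FIBRE COORDINATE `x` (FC f3's binder list VERBATIM, the tested
  variable read at the image point) give `SlotAntiConcentration ((((μK.prod ζ).withDensity Ft).map chart)) u θ ρ
  (2(finrank ℝ Kf + β Σ_p L̄_p(d̄_p + 4s̄_p) + B_𝓔)/(1−δ))` — f3's constant; END-I's seam `hac_of_slotConst` consumes it.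
* §2 PRINT'S SUBSTITUTION SUPPLIES THE CHART (over `ℝ`, `B12Lineariz267` §1 BY NAME): for a linear `L : E → F`
  (print's `LQ̃`) with a linear right inverse `h` («LQ̃h = I»), a map `Ct` (print's `C̃`, `Q̃ = LQ̃ + C̃`) and a map
  `Dt` (print's `D̃`) satisfying the fixed-point equation `C̃(B − hD̃(B)) = D̃(B)` on a window `O` («The function D̃(B)
  is determined by the equation …»): `exists_splitting_of_rightInverse` (the splitting `Ψ (x, b) = x + h b` of
  `E ≃ ker L × F` with `(Ψ.symm y).2 = L y`), `substitution_linearizes` (`Q̃ (B − hD̃(B)) = (Ψ.symm B).2` on `O` —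
  the hypothesis `hlin` of file 1's §3/§4, from `B12Lineariz267.linearizes`), `substitution_injOn` (file 1's `hinj`,
  = `B12Lineariz267.injOn_phi`), `substitution_hasFDerivWithinAt` (file 1's `hΦ'`: derivative `id − h ∘ D̃'`, print's
  «I − h(δ/δB)D̃» of (2.12)), `average_substitution` (the charted point `(h b + x) − hD̃(h b + x)`, `x ∈ ker L`,
  HAS nonlinear average `b`; at `b = 0` this is the δ-fibre «δ(Q̃B′)» charted by `ker LQ̃`).
WHAT REMAINS DISPLAYED (c3-honest).  That Bałaban's block average about the step's background IS of the form
`LQ̃ + C̃` with `C̃` quadratic-analytic in the contraction regime (so that `D̃` exists: `B12Lineariz267.exists_Dt`,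
typed over complexified spaces — the REAL-FORM junction is not made here), the derivative/Jacobian of the substitution
(`B12LinearizAnalytic267`, `B12JacobianTrLog268`, `B12JacobianReal267` — TYPE), the identification of the slot's
density `Ft` with print's integrand (node-U5d/U0 typing), and E2′'s SM-L1…L6 binders in the fibre coordinate.
Nothing printed is asserted; no instance of SM-L1/L3/L4/L6 at any `j ≥ 1`; (M1) per slot stays THE wall.
-/

noncomputable section

open Set Function MeasureTheory MeasureTheory.Measure Metric

namespace Summit.QuantumFields.BalabanUV.T4Continuum.ShellMeasureLinearizedConstraint

open scoped ENNReal NNReal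
open Literature.MathematicalPhysics.QuantumFieldTheory.Balaban1983to89
open T4ShellMeasure (SlotAntiConcentration)
open T4ShellMeasureDet (slotAntiConcentration_map)
open ShellMeasureWilsonTrace (TraceData)
open ShellMeasureWilsonMoving (MLetter mwordEval mdFro sSum lSum)
open ShellMeasureLevelAssembly (classifier weight)
open ShellMeasureRootCompositionFibre (slotAC_fibre_of_levelData)

variable {E F : Type*} [NormedAddCommGroup E] [NormedSpace ℝ E] [NormedAddCommGroup F] [NormedSpace ℝ F]

/-! ## §1 END-II, CONSTRAINED READING: the slot law on the fibre as an image of the product form -/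

section Constrained

variable [MeasurableSpace E] {Kf : Type*} [NormedAddCommGroup Kf] [NormedSpace ℝ Kf]
  [MeasurableSpace Kf] [BorelSpace Kf] [FiniteDimensional ℝ Kf] (μK : Measure Kf) [μK.IsAddHaarMeasure]
variable {A : Type*} [NormedRing A] [NormedAlgebra ℂ A] [CompleteSpace A] [NormOneClass A]

/-- **END-II, CONSTRAINED READING, LINEARIZABLE AVERAGE — REALIZED (M1) FOR THE FIBRE LAW ⇐ SM-L1…L6 + DICTIONARY
IN THE FIBRE COORDINATE, PER SLOT, ANY LEVEL.**  Data: block space `E`, average space `F`, fibre model `Kf` with an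
additive Haar measure `μK`; ANY exterior space `Z` with an s-finite law `ζ`; per exterior point `z` a linear splitting
`Ψ z : Kf × F ≃ E` (of the linearized average) and a curved chart `Φ z : E → E` (print's substitution), the FIBRE
CHART `x ↦ Φ z (Ψ z (x, 0))` being jointly measurable in `(x, z)` (`hch`); a measurable FIBRE DENSITY `Ft` on `Kf × Z`
(print's integrand after the substitution: Jacobian × Haar density × weights, in the fibre coordinate) with finite
slices (`hfin`); a measurable tested variable `u` on `E × Z`.  THE SLOT LAW IS `(((μK.prod ζ).withDensity Ft).map
fun q => (Φ q.2 (Ψ q.2 (q.1, 0)), q.2))` — the δ-constrained law charted by the linear fibre.  LEVEL DATA per `z` IN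
THE FIBRE COORDINATE (FC f3's binder list VERBATIM): `hol`, `Gw`, `𝓔`, `W`, `Jco`, sizes, numbers; DICTIONARY
`hFdict` (`Ft (x, z)` IS `Jco · weight`), `hudict` (`u` at the IMAGE point `Φ z (Ψ z (x, 0))` IS the classifier, on
the support); BINDERS `hJW`/`hJ` (SM-L5/L6), `hAN` (SM-L1), `hGW` (SM-L3), `hE` (SM-L4), `hSM` (SM-L2).
CONCLUSION: `SlotAntiConcentration (slot law) u θ ρ (2(finrank ℝ Kf + β Σ_p L̄_p(d̄_p + 4s̄_p) + B_𝓔)/(1−δ))` — f3's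
constant.  Proof: FC f3 `slotAC_fibre_of_levelData` ∘ `T4ShellMeasureDet.slotAntiConcentration_map`.  CONDITIONAL
on every binder; the presentation of the slot law is the displayed-TYPE reading of print's «δ(Q̃B)» after the
substitution; nothing PRINTED is asserted. [folklore] -/
theorem slotAC_constrainedFibre_of_levelData {Z : Type*} [MeasurableSpace Z] (Ψ : Z → (Kf × F) ≃L[ℝ] E)
    (ζ : Measure Z) [SFinite ζ] {Φ : Z → E → E} (hch : Measurable fun q : Kf × Z => Φ q.2 (Ψ q.2 (q.1, 0)))
    {Ft : Kf × Z → ℝ≥0∞} (hFt : Measurable Ft) (hfin : ∀ z, (μK.withDensity fun x => Ft (x, z)) univ ≠ ∞)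
    {u : E × Z → ℝ} (hu : Measurable u)
    -- level data per exterior point, in the fibre coordinate
    (Ttr : TraceData A) (hN : 0 < Ttr.N) {ι κ : Type*} {Pu : Finset ι} (hPu : Pu.Nonempty)
    (hol : Z → ι → Kf → A) (hcont : ∀ z, ∀ p ∈ Pu, Continuous (hol z p))
    (Pw : Finset κ) (Gw : Z → κ → Kf → A) (𝓔 : Z → Kf → ℝ) (W : Z → Set Kf) (Jco : Z → Kf → ℝ≥0∞)
    {θ δ ρ β Rad H B𝓔 : ℝ} {sw lw dw : κ → ℝ}
    -- DICTIONARY (tested variable read at the image point)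
    (hFdict : ∀ z x, Ft (x, z) = Jco z x * weight Ttr β Pw (Gw z) (𝓔 z) x)
    (hudict : ∀ z x, Ft (x, z) ≠ 0 → u (Φ z (Ψ z (x, 0)), z) = classifier hPu (hol z) x)
    -- SM-L5/L6: kept co-tests supported in the window, centre-monotone
    (hJW : ∀ z x, Jco z x ≠ 0 → x ∈ W z)
    (hJ : ∀ z x, ∀ a : ℝ, 0 ≤ a → Jco z x ≤ Jco z (Real.exp (-a) • x))
    -- SM-L1 (AN-bound)
    (hRad : 1 < Rad)
    (hAN : ∀ z, ∀ x ∈ W z, ∀ p ∈ Pu, ∃ f : ℂ → A, DifferentiableOn ℂ f (ball 0 Rad) ∧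
      (∀ w ∈ ball (0 : ℂ) Rad, ‖f w‖ ≤ H) ∧ f 0 = 0 ∧ ∀ c' : ℝ, 0 ≤ c' → c' ≤ 1 → f (c' : ℂ) = hol z p (c' • x) - 1)
    -- SM-L3 graded sectioned words
    (hGW : ∀ z, ∀ x ∈ W z, ∀ p ∈ Pw, ∃ gw : List (MLetter A × ℝ × ℝ), (∀ y ∈ gw, y.1.Good Ttr.τ y.2.1 y.2.2) ∧
      sSum gw ≤ sw p ∧ lSum gw ≤ lw p ∧ mdFro (gw.map Prod.fst) ≤ dw p ∧
      ∀ c' : ℝ, 0 ≤ c' → c' ≤ 1 → mwordEval c' (gw.map Prod.fst) = Gw z p (c' • x))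
    (hsw1 : ∀ p ∈ Pw, sw p ≤ 1) (hsw0 : ∀ p ∈ Pw, 0 ≤ sw p) (hlw0 : ∀ p ∈ Pw, 0 ≤ lw p)
    (hdw0 : ∀ p ∈ Pw, 0 ≤ dw p)
    -- SM-L4 non-Wilson ray bound
    (hE : ∀ z, ∀ x ∈ W z, ∀ c' : ℝ, 1 / 2 ≤ c' → c' ≤ 1 → 𝓔 z (c' • x) ≤ 𝓔 z x + (1 - c') * B𝓔)
    (hB𝓔 : 0 ≤ B𝓔)
    -- numbers + SM-L2 (SM)
    (hθ : 0 < θ) (hδ0 : 0 ≤ δ) (hδ1 : δ < 1) (hρ0 : 0 ≤ ρ) (hρ : ρ ≤ (1 - δ) / 2) (hβ : 0 ≤ β)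
    (hSM : 36 * H * 1 ^ 2 / (Rad - 1) ^ 2 ≤ δ * θ) :
    SlotAntiConcentration
      (((μK.prod ζ).withDensity Ft).map fun q : Kf × Z => (Φ q.2 (Ψ q.2 (q.1, 0)), q.2)) u θ ρ
      (2 * ((Module.finrank ℝ Kf : ℝ) + (β * ∑ p ∈ Pw, lw p * (dw p + 4 * sw p) + B𝓔)) / (1 - δ)) := by
  have hmap : Measurable fun q : Kf × Z => (Φ q.2 (Ψ q.2 (q.1, 0)), q.2) := hch.prodMk measurable_snd
  refine slotAntiConcentration_map hmap hu ?_
  exact slotAC_fibre_of_levelData μK ζ hFt hfin (u := fun q : Kf × Z => u (Φ q.2 (Ψ q.2 (q.1, 0)), q.2))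
    (hu.comp hmap) Ttr hN hPu hol hcont Pw Gw 𝓔 W Jco hFdict hudict hJW hJ hRad hAN hGW hsw1 hsw0 hlw0 hdw0 hE
    hB𝓔 hθ hδ0 hδ1 hρ0 hρ hβ hSM

end Constrained

/-! ## §2 Print's substitution `B ↦ B − hD̃(B)` supplies the chart (`B12Lineariz267` §1 BY NAME, over `ℝ`) -/

section Substitution

/-- **THE SPLITTING WITH PRINT'S RIGHT INVERSE.**  For a linear `L : E → F` (print's `LQ̃`) with a linear right
inverse `h` («LQ̃h = I») there is a continuous linear chart `Ψ : ker L × F ≃ E`, `Ψ (x, b) = x + h b`, whose second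
inverse coordinate IS `L` (`(Ψ.symm y).2 = L y`): the linear splitting of FC f4 / file 1 with the section `b ↦ h b`
prescribed by print. [folklore] -/
theorem exists_splitting_of_rightInverse (L : E →L[ℝ] F) (h : F →L[ℝ] E) (hLh : ∀ b, L (h b) = b) :
    ∃ Ψ : (LinearMap.ker (L : E →ₗ[ℝ] F) × F) ≃L[ℝ] E,
      (∀ p, Ψ p = (p.1 : E) + h p.2) ∧ ∀ y, (Ψ.symm y).2 = L y := by
  have hker : ∀ y : E, y - h (L y) ∈ LinearMap.ker (L : E →ₗ[ℝ] F) := fun y => by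
    simp [LinearMap.mem_ker, hLh]
  let Φl : (LinearMap.ker (L : E →ₗ[ℝ] F) × F) →L[ℝ] E :=
    ((LinearMap.ker (L : E →ₗ[ℝ] F)).subtypeL.comp (ContinuousLinearMap.fst ℝ _ F)) +
      (h.comp (ContinuousLinearMap.snd ℝ _ F))
  let Ψl : E →L[ℝ] (LinearMap.ker (L : E →ₗ[ℝ] F) × F) :=
    (ContinuousLinearMap.codRestrict ((ContinuousLinearMap.id ℝ E) - h.comp L) _ hker).prod L
  have hΦl : ∀ p, Φl p = (p.1 : E) + h p.2 := fun p => rfl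
  have h1 : ∀ p, Ψl (Φl p) = p := by
    rintro ⟨x, b⟩
    have hx : L (x : E) = 0 := x.2
    refine Prod.ext (Subtype.ext ?_) ?_
    · show ((x : E) + h b) - h (L ((x : E) + h b)) = x
      rw [map_add, hx, hLh, zero_add, add_sub_cancel_right]
    · show L ((x : E) + h b) = b
      rw [map_add, hx, hLh, zero_add]
  have h2 : ∀ y, Φl (Ψl y) = y := fun y => by
    show (y - h (L y)) + h (L y) = y
    abel
  refine ⟨ContinuousLinearEquiv.equivOfInverse Φl Ψl h1 h2, fun p => hΦl p, fun y => ?_⟩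
  rw [ContinuousLinearEquiv.symm_equivOfInverse, ContinuousLinearEquiv.equivOfInverse_apply]
  rfl

/-- **PRINT'S SUBSTITUTION LINEARIZES THE AVERAGE INTO THE SPLITTING COORDINATE** — the hypothesis `hlin` of file 1's
§3/§4.  Data over `ℝ`: `L` (print's `LQ̃`), `h` («LQ̃h = I»), `Ct` (print's `C̃`; the nonlinear average is
`Q̃ y = L y + C̃ y`), `Dt` (print's `D̃`) with the fixed-point equation `C̃(B − hD̃(B)) = D̃(B)` on the window `O`
(«The function D̃(B) is determined by the equation»), and ANY splitting `Ψ` whose second inverse coordinate is `L`.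
Then `Q̃ (B − hD̃(B)) = (Ψ.symm B).2` for `B ∈ O` — `B12Lineariz267.linearizes` BY NAME. [folklore] -/
theorem substitution_linearizes (L : E →L[ℝ] F) (h : F →L[ℝ] E) (hLh : ∀ b, L (h b) = b) (Ct Dt : E → F)
    {O : Set E} (hfix : ∀ B ∈ O, Ct (B - h (Dt B)) = Dt B) {Kf : Type*} [NormedAddCommGroup Kf]
    [NormedSpace ℝ Kf] (Ψ : (Kf × F) ≃L[ℝ] E) (hΨ : ∀ y, (Ψ.symm y).2 = L y) :
    ∀ B ∈ O, L (B - h (Dt B)) + Ct (B - h (Dt B)) = (Ψ.symm B).2 := fun B hB => by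
  rw [hΨ]
  exact B12Lineariz267.linearizes (LQ := (L : E →ₗ[ℝ] F)) (hop := (h : F →ₗ[ℝ] E)) (Ct := Ct) hLh (hfix B hB)

/-- **… AND IS INJECTIVE ON THE WINDOW** — the hypothesis `hinj` of file 1, `B12Lineariz267.injOn_phi` BY NAME (from
the explicit left inverse `B′ ↦ B′ + hC̃(B′)`, no Lipschitz bound needed). [folklore] -/
theorem substitution_injOn (h : F →L[ℝ] E) (Ct Dt : E → F) {O : Set E}
    (hfix : ∀ B ∈ O, Ct (B - h (Dt B)) = Dt B) : InjOn (fun B => B - h (Dt B)) O :=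
  B12Lineariz267.injOn_phi (hop := (h : F →ₗ[ℝ] E)) (Ct := Ct) hfix

/-- **… WITH DERIVATIVE `I − h∘DD̃`** — the hypothesis `hΦ'` of file 1: if `D̃` has derivative `D' B` within the
window at `B`, the substitution has derivative `id − h ∘ D' B` there (print's Jacobian operator «I − h(δ/δB)D̃» of
(2.12), typed as `DΦ(B) = 1 − J(B)` in `B12JacobianTrLog268`). [folklore] -/
theorem substitution_hasFDerivWithinAt (h : F →L[ℝ] E) (Dt : E → F) {O : Set E} {B : E} {D' : E →L[ℝ] F}
    (hD : HasFDerivWithinAt Dt D' O B) :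
    HasFDerivWithinAt (fun B => B - h (Dt B)) (ContinuousLinearMap.id ℝ E - h.comp D') O B :=
  (hasFDerivWithinAt_id B O).sub (h.hasFDerivAt.comp_hasFDerivWithinAt B hD)

/-- **THE CHARTED POINT HAS NONLINEAR AVERAGE `b`.**  With print's section `b ↦ h b` and a fibre coordinate
`x : Kf` (`Ψ (x, 0) ∈ ker L`): if `h b + Ψ (x, 0) ∈ O` then `Q̃ ((h b + Ψ (x, 0)) − hD̃(h b + Ψ (x, 0))) = b`.  At
`b = 0` (print's relative variables: the constraint is `Q̃(B′) = 0`, (2.4)/(2.10)) this says: the δ-fibre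
«δ(Q̃B′)» inside the window is charted by `x ↦ x − hD̃(x)`, `x` in the LINEAR fibre `ker LQ̃` — «the integral with
the δ-function δ(Q̃B)». [folklore] -/
theorem average_substitution (L : E →L[ℝ] F) (h : F →L[ℝ] E) (hLh : ∀ b, L (h b) = b) (Ct Dt : E → F)
    {O : Set E} (hfix : ∀ B ∈ O, Ct (B - h (Dt B)) = Dt B) {Kf : Type*} [NormedAddCommGroup Kf]
    [NormedSpace ℝ Kf] (Ψ : (Kf × F) ≃L[ℝ] E) (hΨ : ∀ y, (Ψ.symm y).2 = L y) (x : Kf) (b : F)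
    (hx : h b + Ψ (x, 0) ∈ O) :
    L ((h b + Ψ (x, 0)) - h (Dt (h b + Ψ (x, 0)))) + Ct ((h b + Ψ (x, 0)) - h (Dt (h b + Ψ (x, 0)))) = b := by
  rw [substitution_linearizes L h hLh Ct Dt hfix Ψ hΨ _ hx, map_add, Prod.snd_add, hΨ, hLh,
    ContinuousLinearEquiv.symm_apply_apply, add_zero]

end Substitution

end Summit.QuantumFields.BalabanUV.T4Continuum.ShellMeasureLinearizedConstraint

end
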